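import Mathlib.Combinatorics.Enumerative.Partition.Basic
import Mathlib.Data.Multiset.Fintype
import Literature.Computability.AlgebraicComplexity.QuantumFunctionalsKroneckerFacts
import Literature.NumberTheory.DiophantineGeometry.SymmetricGroupReps
import HarnessLib

/-!
# The upper quantum functional `F^θ` (Christandl–Vrana–Zuiddam, Def. 3.3) in coordinates, `k = 3`

Topic `Literature/Computability/AlgebraicComplexity`; decomposition file (layer 1 of the deep half)
for the named fact `ChristandlVranaZuiddam2023_universalSpectralPoint` (`QuantumFunctionals.lean`,
CVZ Cor. 3.31). The tree's `quantumFunctional θ = F_θ` is the *lower* quantum functional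
(Def. 3.16). Of the four spectral-point properties of Cor. 3.31, normalisation
(`ChristandlVranaZuiddam2023_unitTensor_holds`), restriction monotonicity
(`ChristandlVranaZuiddam2023_restriction_mono_holds`), super-additivity and super-multiplicativity
(Thm. 3.19, `ChristandlVranaZuiddam2023_kronecker_ge`, …) are proved in sibling files; the two
remaining inequalities — sub-additivity and sub-multiplicativity of `F_θ`, vendored as the named
facts `ChristandlVranaZuiddam2023_directSum_subadditive` (`QuantumFunctionalsDirectSum.lean`) /
`ChristandlVranaZuiddam2023_kronecker_le` (`QuantumFunctionalsKroneckerFacts.lean`) — are in the source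
consequences of three printed results about the **upper** quantum functional `F^θ`
(Def. 3.3), which this file DEFINES (in coordinates, for 3-tensors and `θ ∈ P([3])`) and about which
it VENDORS those three results:

* Lemma 3.11 (`ChristandlVranaZuiddam2023_upper_subadditive`): `F^θ(s ⊕ t) ≤ F^θ(s) + F^θ(t)`;
* Lemma 3.13 (`ChristandlVranaZuiddam2023_upper_submultiplicative`): `F^θ(s ⊗ t) ≤ F^θ(s) F^θ(t)`;
* Thm. 3.30 (`ChristandlVranaZuiddam2023_upper_eq_lower`): `E^θ(t) = E_θ(t)` for `θ ∈ P_s(B)`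
  (for `k = 3`, `P_s(B) = P(B) = P([3])`; its printed proof is Thm. 3.24, `E^θ ≥ E_θ`, by Keyl–Werner
  spectrum estimation and the gentle measurement lemma, plus the entanglement-polytope
  characterisation Thm. 3.29 of Brion / Walter–Doran–Gross–Christandl);

and it PROVES the reduction `ChristandlVranaZuiddam2023_kronecker_le_of_upper` (Lemma 3.13 + Thm. 3.30
⇒ `_kronecker_le`) and the analogous `quantumFunctional_directSumTensor_le_of_upper`
(Lemma 3.11 + Thm. 3.30 ⇒ `F_θ(s ⊕ t) ≤ F_θ(s) + F_θ(t)`, the body of `_directSum_subadditive`; the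
one-line reductions `ChristandlVranaZuiddam2023_directSum_subadditive_of_upper` and
`ChristandlVranaZuiddam2023_universalSpectralPoint_of_upper` live in
`QuantumFunctionalsDirectSumUpper.lean` and `QuantumFunctionalsSpectralPointUpper.lean`, which import
both sides). Monotonicity of `F^θ` under changes of bases and degenerations within a format (Lemma 3.6)
is proved in `QuantumFunctionalsUpperMonotone.lean`.

## The definition (CVZ §3.1, Def. 3.3 and the displays before it; case `k = 3`, `θ ∈ P([3])`)

For `t ∈ ℂ^ι ⊗ ℂ^κ ⊗ ℂ^μ` the tensor power `t^{⊗n}` is the tree's `kroneckerPow t n` on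
`(Fin n → ι) × (Fin n → κ) × (Fin n → μ)`. The symmetric group `S_n = Equiv.Perm (Fin n)` acts on the
`n` legs of the `j`-th factor (`permLegs₁/₂/₃ π u`, e.g. `(π ·₁ u)(a, b, c) = u(a ∘ π, b, c)`): this is
the action of `S_n` on `V_j^{⊗n}` in `(V_1 ⊗ V_2 ⊗ V_3)^{⊗n} ≅ V_j^{⊗n} ⊗ V_{ĵ}^{⊗n}` with `GL`/`S_n`
acting trivially on the second factor (§3.1, the decomposition defining `P_λ^{V_S}`, here `S = {j}`).
For a partition `λ ⊢ n` with Specht character `χ_λ` (`Literature.NumberTheory.DiophantineGeometry.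
spechtCharacter ℂ λ`, the irreducible character of `S_n` labelled by `λ` in characteristic `0`) the
operator `isotypicSumⱼ λ = ∑_{π ∈ S_n} χ_λ(π) (π ·ⱼ –)` is `n!/χ_λ(1)` times the isotypic
(equivariant) projector `P_λ^{V_j}` of §3.1 (the central idempotent `(χ(1)/|G|) ∑_g χ(g⁻¹) g`;
`χ_λ(π⁻¹) = χ_λ(π)` for `S_n`), so `isotypicSumⱼ λ u ≠ 0 ↔ P_λ^{V_j} u ≠ 0`; only this
non-vanishing enters Def. 3.3. For `θ ∈ P([3]) = P_s(B)` the bipartitions in the support of `θ` are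
`{{j}, [3]∖{j}}` with `θ(j) ≠ 0`, the projectors `P_{λ^{(j)}}^{V_j}` pairwise commute (Lemma 3.2), and on
`t^{⊗n} ∈ Sym^n` the extra symmetriser `P_{(n)}` in `P_λ^{V_b} := P_λ^{V_S} P_{(n)}` (before Lemma 3.2) acts as the
identity. Hence Def. 3.3 reads, for `t ≠ 0`:

  `E^θ(t) = sup { ∑_{j : θ(j) ≠ 0} θ(j) H(λ^{(j)}/n) : n ≥ 1, λ^{(j)} ⊢ n,`
  `            (∏_{j : θ(j) ≠ 0} P_{λ^{(j)}}^{V_j}) t^{⊗n} ≠ 0 }`,  `F^θ(t) = 2^{E^θ(t)}`, `F^θ(0) = 0`,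

which is `upperLogQuantumFunctional θ t` / `upperQuantumFunctional θ t` below (`UpperAdmissible`
is the constraint, verbatim; factors with `θ(j) = 0` are skipped exactly as in the source, where the
product and the sum range over `supp θ`).

## Design choices and wording risks

* **Finiteness of the supremum.** As printed, the supremum ranges over all `λ^{(j)} ⊢ n` (no bound on
  the number of parts is imposed in `UpperAdmissible`). It is finite because tuples with
  `ℓ(λ^{(j)}) > dim V_j` never satisfy the constraint: `P_λ^{V} = 0` on `V^{⊗n}` when `ℓ(λ) > dim V`
  (Schur–Weyl duality, display (sw) of §3.1: "`S_λ(V)` is an irreducible `GL(V)`-module if `ℓ(λ) ≤ d`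
  and `0` otherwise"). That vanishing is vendored here as the named fact
  `schurWeyl_isotypicSum_eq_zero` (not in Mathlib; dischargeable from the tree's proved
  `Literature.NumberTheory.DiophantineGeometry.weylModule_eq_bot_of_card_lt` —
  `c_μ · (k^σ)^{⊗d} = ⊥` for `|σ| < ℓ(μ)`, `SchurWeylPlethysmProofs.lean` — once the character sum
  `∑_π χ_μ(π) π` is shown to lie in the two-sided ideal of the Young symmetrizer `c_μ` and the function
  model here is bridged to `TensorPower`), and `upperLogQuantumFunctional_le` derives from it
  the bound `E^θ(t) ≤ ∑ θ(j) log₂ dim V_j`, i.e. that the `sSup` is over a bounded set (were the set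
  unbounded, `Real.sSup` would return the junk value `0`).
* **Junk values.** `E^θ(0) = sSup ∅ = 0` (source: `-∞`); `F^θ(0) = 0` as printed. Entropies in bits.
  `partitionEntropy λ = H(λ̄)`, `λ̄ = (λ₁/n, …, λ_ℓ/n)` (§3, before §3.1).
* **Normalisation of the projector** is irrelevant for Def. 3.3 (only `≠ 0` is used), so the
  unnormalised character sum is taken as the definition; identifying it with the isotypic projector
  uses the irreducibility and distinctness of the complex Specht modules (named facts
  `isIrreducible_spechtRep`, `nonempty_equiv_iff` of `SymmetricGroupReps.lean`).
* Not vendored here: Thm. 3.5.1/3.5.4 (normalisation and monotonicity of `F^θ`), Lemma 3.10, Thm. 3.24,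
  Thm. 3.29 separately — the next layer of the decomposition (see the unit's `NOTES.md`).

## Source

M. Christandl, P. Vrana, J. Zuiddam, *Universal points in the asymptotic spectrum of tensors*,
J. Amer. Math. Soc. 36 (2023) 31–79 = arXiv:1709.07851v3: §3.1 ((sw), Lemma 3.1, 3.2,
Def. 3.3, Rem. 3.4, Thm. 3.5, Lemma 3.11, 3.13), §3.3 (Thm. 3.24), §3.4 (Thm. 3.29, Thm. 3.30,
Cor. 3.31).
-/

noncomputable section

open scoped BigOperators
open Real (negMulLog)

namespace Literature.Computability.AlgebraicComplexity

open Literature.NumberTheory.DiophantineGeometry (spechtCharacter)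

universe u

/-! ## Leg permutations and isotypic character sums on tensor powers -/

section Legs

variable {K : Type*} {ι κ μ : Type*} {n : ℕ}

/-- The action of `π ∈ S_n` on the `n` legs of the **first** factor of an `n`-fold tensor power in
coordinates: `(π ·₁ u)(a, b, c) = u(a ∘ π, b, c)` (CVZ §3.1: `S_n` permuting the tensor legs of
`V_S^{⊗n}`, here `S = {1}`). [cite: ChristandlVranaZuiddam2023, §3.1] -/
def permLegs₁ (π : Equiv.Perm (Fin n)) (u : (Fin n → ι) → (Fin n → κ) → (Fin n → μ) → K) :
    (Fin n → ι) → (Fin n → κ) → (Fin n → μ) → K :=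
  fun a b c => u (a ∘ π) b c

/-- The action of `π ∈ S_n` on the legs of the **second** factor: `(π ·₂ u)(a, b, c) = u(a, b ∘ π, c)`.
[cite: ChristandlVranaZuiddam2023, §3.1] -/
def permLegs₂ (π : Equiv.Perm (Fin n)) (u : (Fin n → ι) → (Fin n → κ) → (Fin n → μ) → K) :
    (Fin n → ι) → (Fin n → κ) → (Fin n → μ) → K :=
  fun a b c => u a (b ∘ π) c

/-- The action of `π ∈ S_n` on the legs of the **third** factor: `(π ·₃ u)(a, b, c) = u(a, b, c ∘ π)`.
[cite: ChristandlVranaZuiddam2023, §3.1] -/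
def permLegs₃ (π : Equiv.Perm (Fin n)) (u : (Fin n → ι) → (Fin n → κ) → (Fin n → μ) → K) :
    (Fin n → ι) → (Fin n → κ) → (Fin n → μ) → K :=
  fun a b c => u a b (c ∘ π)

/-- Unfolding of `permLegs₁`. [folklore] -/
@[simp] theorem permLegs₁_apply (π : Equiv.Perm (Fin n))
    (u : (Fin n → ι) → (Fin n → κ) → (Fin n → μ) → K) (a : Fin n → ι) (b : Fin n → κ)
    (c : Fin n → μ) : permLegs₁ π u a b c = u (a ∘ π) b c := rfl

/-- Unfolding of `permLegs₂`. [folklore] -/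
@[simp] theorem permLegs₂_apply (π : Equiv.Perm (Fin n))
    (u : (Fin n → ι) → (Fin n → κ) → (Fin n → μ) → K) (a : Fin n → ι) (b : Fin n → κ)
    (c : Fin n → μ) : permLegs₂ π u a b c = u a (b ∘ π) c := rfl

/-- Unfolding of `permLegs₃`. [folklore] -/
@[simp] theorem permLegs₃_apply (π : Equiv.Perm (Fin n))
    (u : (Fin n → ι) → (Fin n → κ) → (Fin n → μ) → K) (a : Fin n → ι) (b : Fin n → κ)
    (c : Fin n → μ) : permLegs₃ π u a b c = u a b (c ∘ π) := rfl

/-- The identity permutation acts trivially. [folklore] -/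
@[simp] theorem permLegs₁_one (u : (Fin n → ι) → (Fin n → κ) → (Fin n → μ) → K) :
    permLegs₁ 1 u = u := rfl

/-- `permLegs₁` is a left action: `(σπ) ·₁ u = σ ·₁ (π ·₁ u)`. [folklore] -/
theorem permLegs₁_mul (σ π : Equiv.Perm (Fin n)) (u : (Fin n → ι) → (Fin n → κ) → (Fin n → μ) → K) :
    permLegs₁ (σ * π) u = permLegs₁ σ (permLegs₁ π u) := rfl

/-- `permLegs₂` is a left action. [folklore] -/
theorem permLegs₂_mul (σ π : Equiv.Perm (Fin n)) (u : (Fin n → ι) → (Fin n → κ) → (Fin n → μ) → K) :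
    permLegs₂ (σ * π) u = permLegs₂ σ (permLegs₂ π u) := rfl

/-- `permLegs₃` is a left action. [folklore] -/
theorem permLegs₃_mul (σ π : Equiv.Perm (Fin n)) (u : (Fin n → ι) → (Fin n → κ) → (Fin n → μ) → K) :
    permLegs₃ (σ * π) u = permLegs₃ σ (permLegs₃ π u) := rfl

/-- The leg actions on different factors commute. [cite: ChristandlVranaZuiddam2023, Lemma 3.2] -/
theorem permLegs₁_permLegs₂ (σ π : Equiv.Perm (Fin n))
    (u : (Fin n → ι) → (Fin n → κ) → (Fin n → μ) → K) :
    permLegs₁ σ (permLegs₂ π u) = permLegs₂ π (permLegs₁ σ u) := rfl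

/-- A tensor power `t^{⊗n}` is a symmetric tensor: invariant under the simultaneous permutation of
the legs of all three factors (CVZ §3.1, before Lemma 3.1: powers `t^{⊗n}` lie in the symmetric
subspace, so the symmetriser `P_{(n)}` fixes them). [cite: ChristandlVranaZuiddam2023, §3.1] -/
theorem permLegs_kroneckerPow [CommSemiring K] (π : Equiv.Perm (Fin n)) (t : ι → κ → μ → K) :
    permLegs₁ π (permLegs₂ π (permLegs₃ π (kroneckerPow t n))) = kroneckerPow t n := by
  funext a b c
  simp only [permLegs₁_apply, permLegs₂_apply, permLegs₃_apply, kroneckerPow_apply]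
  exact Fintype.prod_equiv π _ _ fun _ => rfl

/-- Leg permutations fix the zero tensor. [folklore] -/
@[simp] theorem permLegs₁_zero [Zero K] (π : Equiv.Perm (Fin n)) :
    permLegs₁ π (0 : (Fin n → ι) → (Fin n → κ) → (Fin n → μ) → K) = 0 := rfl

/-- Leg permutations fix the zero tensor. [folklore] -/
@[simp] theorem permLegs₂_zero [Zero K] (π : Equiv.Perm (Fin n)) :
    permLegs₂ π (0 : (Fin n → ι) → (Fin n → κ) → (Fin n → μ) → K) = 0 := rfl

/-- Leg permutations fix the zero tensor. [folklore] -/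
@[simp] theorem permLegs₃_zero [Zero K] (π : Equiv.Perm (Fin n)) :
    permLegs₃ π (0 : (Fin n → ι) → (Fin n → κ) → (Fin n → μ) → K) = 0 := rfl

/-- The **isotypic character sum** on the first factor: `∑_{π ∈ S_n} χ_λ(π) (π ·₁ u)`, which is
`n!/χ_λ(1)` times the equivariant projector `P_λ^{V_1} u` of CVZ §3.1 (isotypic projector of the
`S_n`-module `V_1^{⊗n}`, with `V_2, V_3`-legs as multiplicity space), `χ_λ` the complex Specht
(irreducible) character of `λ ⊢ n`. [cite: ChristandlVranaZuiddam2023, §3.1] -/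
def isotypicSum₁ (lam : Nat.Partition n) (u : (Fin n → ι) → (Fin n → κ) → (Fin n → μ) → ℂ) :
    (Fin n → ι) → (Fin n → κ) → (Fin n → μ) → ℂ :=
  ∑ π : Equiv.Perm (Fin n), spechtCharacter ℂ lam π • permLegs₁ π u

/-- The isotypic character sum `∑_π χ_λ(π) (π ·₂ u)` on the second factor (`∝ P_λ^{V_2} u`).
[cite: ChristandlVranaZuiddam2023, §3.1] -/
def isotypicSum₂ (lam : Nat.Partition n) (u : (Fin n → ι) → (Fin n → κ) → (Fin n → μ) → ℂ) :
    (Fin n → ι) → (Fin n → κ) → (Fin n → μ) → ℂ :=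
  ∑ π : Equiv.Perm (Fin n), spechtCharacter ℂ lam π • permLegs₂ π u

/-- The isotypic character sum `∑_π χ_λ(π) (π ·₃ u)` on the third factor (`∝ P_λ^{V_3} u`).
[cite: ChristandlVranaZuiddam2023, §3.1] -/
def isotypicSum₃ (lam : Nat.Partition n) (u : (Fin n → ι) → (Fin n → κ) → (Fin n → μ) → ℂ) :
    (Fin n → ι) → (Fin n → κ) → (Fin n → μ) → ℂ :=
  ∑ π : Equiv.Perm (Fin n), spechtCharacter ℂ lam π • permLegs₃ π u

/-- Unfolding of `isotypicSum₁`. [folklore] -/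
theorem isotypicSum₁_def (lam : Nat.Partition n) (u : (Fin n → ι) → (Fin n → κ) → (Fin n → μ) → ℂ) :
    isotypicSum₁ lam u = ∑ π : Equiv.Perm (Fin n), spechtCharacter ℂ lam π • permLegs₁ π u := rfl

/-- The isotypic sums kill the zero tensor. [folklore] -/
@[simp] theorem isotypicSum₁_zero (lam : Nat.Partition n) :
    isotypicSum₁ lam (0 : (Fin n → ι) → (Fin n → κ) → (Fin n → μ) → ℂ) = 0 := by
  simp [isotypicSum₁]

/-- The isotypic sums kill the zero tensor. [folklore] -/
@[simp] theorem isotypicSum₂_zero (lam : Nat.Partition n) :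
    isotypicSum₂ lam (0 : (Fin n → ι) → (Fin n → κ) → (Fin n → μ) → ℂ) = 0 := by
  simp [isotypicSum₂]

/-- The isotypic sums kill the zero tensor. [folklore] -/
@[simp] theorem isotypicSum₃_zero (lam : Nat.Partition n) :
    isotypicSum₃ lam (0 : (Fin n → ι) → (Fin n → κ) → (Fin n → μ) → ℂ) = 0 := by
  simp [isotypicSum₃]

end Legs

/-! ## Entropy of a normalised partition -/

section PartitionEntropy

variable {n : ℕ}

/-- `H(λ̄)`, the Shannon entropy in bits of the probability distribution `λ̄ = (λ₁/n, …, λ_ℓ/n)` of a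
partition `λ ⊢ n` (CVZ §3, before §3.1: "For a partition `λ ⊢ n` let `λ̄ = (λ₁/n, …, λ_d/n)` …
Shannon entropy `H(λ̄)`"). [cite: ChristandlVranaZuiddam2023, §3] -/
def partitionEntropy (lam : Nat.Partition n) : ℝ :=
  (lam.parts.map fun p : ℕ => negMulLog ((p : ℝ) / n)).sum / Real.log 2

/-- Unfolding of `partitionEntropy`. [folklore] -/
theorem partitionEntropy_def (lam : Nat.Partition n) :
    partitionEntropy lam = (lam.parts.map fun p : ℕ => negMulLog ((p : ℝ) / n)).sum / Real.log 2 :=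
  rfl

/-- `H(λ̄) ≥ 0` (each `λᵢ/n ∈ [0, 1]`). [folklore] -/
theorem partitionEntropy_nonneg (lam : Nat.Partition n) : 0 ≤ partitionEntropy lam := by
  refine div_nonneg (Multiset.sum_nonneg fun x hx => ?_) (Real.log_nonneg one_le_two)
  obtain ⟨p, hp, rfl⟩ := Multiset.mem_map.1 hx
  refine Real.negMulLog_nonneg (by positivity) ?_
  rcases Nat.eq_zero_or_pos n with hn | hn
  · subst hn; simp
  · exact div_le_one_of_le₀ (by exact_mod_cast Nat.Partition.le_of_mem_parts hp) (by positivity)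

/-- A multiset sum as a sum over the multiset coerced to a type. [folklore] -/
theorem multiset_map_sum_eq_sum_coe {α : Type*} [DecidableEq α] (m : Multiset α) (g : α → ℝ) :
    (m.map g).sum = ∑ x : m, g (x : α) := by
  rw [← Multiset.map_univ m g, ← Finset.sum_eq_multiset_sum]

/-- `H(λ̄) ≤ log₂ ℓ(λ)`: the entropy of a distribution on `ℓ` points is at most `log₂ ℓ`. [folklore] -/
theorem partitionEntropy_le_log_card (lam : Nat.Partition n) :
    partitionEntropy lam ≤ Real.log (Multiset.card lam.parts) / Real.log 2 := by
  classical
  rcases Nat.eq_zero_or_pos n with hn | hn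
  · subst hn
    simp [partitionEntropy]
  set P : lam.parts → ℝ := fun x => ((x : ℕ) : ℝ) / n with hP
  have hPs : P ∈ stdSimplex ℝ lam.parts := by
    refine ⟨fun x => by positivity, ?_⟩
    simp only [hP]
    rw [← Finset.sum_div, ← multiset_map_sum_eq_sum_coe lam.parts (fun p : ℕ => (p : ℝ)),
      ← Nat.cast_multiset_sum, lam.parts_sum]
    exact div_self (by exact_mod_cast hn.ne')
  have h := shannonEntropy_le_of_mem_stdSimplex hPs
  rw [Multiset.card_coe] at h
  calc partitionEntropy lam = shannonEntropy P := by
        rw [partitionEntropy, shannonEntropy_def, multiset_map_sum_eq_sum_coe]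
    _ ≤ _ := h

end PartitionEntropy

/-! ## The upper quantum functional (CVZ Def. 3.3, `k = 3`, `θ ∈ P([3])`) -/

section Upper

variable {ι κ μ : Type u} [Fintype ι] [Fintype κ] [Fintype μ]

/-- The operator `∏_{j : θ(j) ≠ 0} P_{λ^{(j)}}^{V_j}` of CVZ Def. 3.3 up to a nonzero scalar, in
coordinates: apply the isotypic character sum of `λ^{(j)}` on the legs of factor `j` for every `j` in
the support of `θ` (the three operators commute, Lemma 3.2, so the order is immaterial).
[cite: ChristandlVranaZuiddam2023, Def. 3.3] -/
def upperProjection (θ : Fin 3 → ℝ) {n : ℕ} (lam : Fin 3 → Nat.Partition n)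
    (u : (Fin n → ι) → (Fin n → κ) → (Fin n → μ) → ℂ) : (Fin n → ι) → (Fin n → κ) → (Fin n → μ) → ℂ :=
  open Classical in
  let u₃ := if θ 2 = 0 then u else isotypicSum₃ (lam 2) u
  let u₂ := if θ 1 = 0 then u₃ else isotypicSum₂ (lam 1) u₃
  if θ 0 = 0 then u₂ else isotypicSum₁ (lam 0) u₂

omit [Fintype ι] [Fintype κ] [Fintype μ] in
/-- The upper projection of the zero tensor vanishes. [folklore] -/
@[simp] theorem upperProjection_zero (θ : Fin 3 → ℝ) {n : ℕ} (lam : Fin 3 → Nat.Partition n) :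
    upperProjection θ lam (0 : (Fin n → ι) → (Fin n → κ) → (Fin n → μ) → ℂ) = 0 := by
  simp only [upperProjection]
  split_ifs <;> simp

/-- **Admissible tuples of Def. 3.3** for `θ ∈ P([3])` and `n ≥ 1`: triples of partitions
`λ^{(1)}, λ^{(2)}, λ^{(3)} ⊢ n` with `(∏_{j ∈ supp θ} P_{λ^{(j)}}^{V_j}) t^{⊗n} ≠ 0` (the printed
constraint; `λ^{(j)}` for `j ∉ supp θ` is a dummy that enters neither the constraint nor the objective).
[cite: ChristandlVranaZuiddam2023, Def. 3.3] -/
def UpperAdmissible (θ : Fin 3 → ℝ) (t : ι → κ → μ → ℂ) (n : ℕ) (lam : Fin 3 → Nat.Partition n) :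
    Prop :=
  upperProjection θ lam (kroneckerPow t n) ≠ 0

/-- The `θ`-weighted entropy `∑_j θ(j) H(λ̄^{(j)})` of a tuple of partitions (the objective of
Def. 3.3; terms with `θ(j) = 0` vanish, matching the source's sum over `supp θ`).
[cite: ChristandlVranaZuiddam2023, Def. 3.3] -/
def weightedPartitionEntropy (θ : Fin 3 → ℝ) {n : ℕ} (lam : Fin 3 → Nat.Partition n) : ℝ :=
  θ 0 * partitionEntropy (lam 0) + θ 1 * partitionEntropy (lam 1) + θ 2 * partitionEntropy (lam 2)

/-- **The logarithmic upper quantum functional** `E^θ(t)` (CVZ Def. 3.3, `k = 3`, `θ ∈ P([3])`):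
the supremum of `∑_{j ∈ supp θ} θ(j) H(λ̄^{(j)})` over `n ≥ 1` and admissible tuples
`(λ^{(j)} ⊢ n)_j`, i.e. those with `(∏_{j ∈ supp θ} P_{λ^{(j)}}^{V_j}) t^{⊗n} ≠ 0`. The set is
bounded above by `∑ θ(j) log₂ dim V_j` by Schur–Weyl duality (`upperLogQuantumFunctional_le`, from the
named fact `schurWeyl_isotypicSum_eq_zero`); `E^θ(0) = sSup ∅ = 0` (source: `-∞`).
[cite: ChristandlVranaZuiddam2023, Def. 3.3] -/
def upperLogQuantumFunctional (θ : Fin 3 → ℝ) (t : ι → κ → μ → ℂ) : ℝ :=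
  sSup {x : ℝ | ∃ (n : ℕ) (lam : Fin 3 → Nat.Partition n),
    0 < n ∧ UpperAdmissible θ t n lam ∧ x = weightedPartitionEntropy θ lam}

/-- **The upper quantum functional** `F^θ(t) = 2^{E^θ(t)}` for `t ≠ 0`, `F^θ(0) = 0` (CVZ Def. 3.3).
[cite: ChristandlVranaZuiddam2023, Def. 3.3] -/
def upperQuantumFunctional [DecidableEq ι] [DecidableEq κ] [DecidableEq μ] (θ : Fin 3 → ℝ)
    (t : ι → κ → μ → ℂ) : ℝ :=
  if t = 0 then 0 else (2 : ℝ) ^ upperLogQuantumFunctional θ t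

/-- **Schur–Weyl vanishing** (CVZ §3.1, display (sw): "`V^{⊗n} ≅ ⊕_{λ ⊢ n} S_λ(V) ⊗ [λ]`, where
`[λ]` is an irreducible `S_n`-module and `S_λ(V)` is an irreducible `GL(V)`-module if `ℓ(λ) ≤ d` and
`0` otherwise"; Fulton–Harris, Thm. 6.3 (1)): the `λ`-isotypic component of the `S_n`-module `V^{⊗n}`,
`d = dim V`, vanishes when `λ` has more than `d` parts. In coordinates, for each of the three leg
actions: if `ℓ(λ) > |ι|` then `∑_π χ_λ(π) (π ·₁ u) = 0` for every `u`, and likewise for the second and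
third factor. (This makes the supremum in Def. 3.3 finite; it uses that the complex Specht characters
are the irreducible characters of `S_n`.) Discharge route: the tree proves
`Literature.NumberTheory.DiophantineGeometry.weylModule_eq_bot_of_card_lt` (`c_μ · (k^σ)^{⊗d} = ⊥` when
`|σ| < ℓ(μ)`, `SchurWeylPlethysmProofs.lean`); it remains to show that `∑_π χ_μ(π) π` lies in the
two-sided ideal `ℂ[S_n] c_μ ℂ[S_n]` (Wedderburn block of `[μ]`) and to bridge this file's function model
of `V^{⊗n}` to `TensorPower ℂ n (ι → ℂ)` with its `permTensorRep`.
[cite: ChristandlVranaZuiddam2023, §3.1 (sw)] -/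
def schurWeyl_isotypicSum_eq_zero : Prop :=
  ∀ {ι κ μ : Type u} [Fintype ι] [Fintype κ] [Fintype μ] {n : ℕ} (lam : Nat.Partition n)
    (u : (Fin n → ι) → (Fin n → κ) → (Fin n → μ) → ℂ),
    (Fintype.card ι < Multiset.card lam.parts → isotypicSum₁ lam u = 0) ∧
    (Fintype.card κ < Multiset.card lam.parts → isotypicSum₂ lam u = 0) ∧
    (Fintype.card μ < Multiset.card lam.parts → isotypicSum₃ lam u = 0)

/-- Under Schur–Weyl vanishing, an admissible tuple has `ℓ(λ^{(j)}) ≤ dim V_j` for every `j ∈ supp θ`.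
[cite: ChristandlVranaZuiddam2023, §3.1 (sw)] -/
theorem UpperAdmissible.card_parts_le (hSW : schurWeyl_isotypicSum_eq_zero.{u}) {θ : Fin 3 → ℝ}
    {t : ι → κ → μ → ℂ} {n : ℕ} {lam : Fin 3 → Nat.Partition n} (h : UpperAdmissible θ t n lam) :
    (θ 0 ≠ 0 → Multiset.card (lam 0).parts ≤ Fintype.card ι) ∧
    (θ 1 ≠ 0 → Multiset.card (lam 1).parts ≤ Fintype.card κ) ∧
    (θ 2 ≠ 0 → Multiset.card (lam 2).parts ≤ Fintype.card μ) := by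
  classical
  unfold UpperAdmissible upperProjection at h
  refine ⟨fun h0 => ?_, fun h1 => ?_, fun h2 => ?_⟩ <;> refine le_of_not_gt fun hlt => h ?_
  · rw [if_neg h0]
    exact (hSW (lam 0) _).1 hlt
  · simp only [if_neg h1]
    rw [(hSW (lam 1) _).2.1 hlt]
    split_ifs <;> simp
  · simp only [if_neg h2]
    rw [(hSW (lam 2) _).2.2 hlt]
    split_ifs <;> simp

/-- The value of an admissible tuple is at most `∑ θ(j) log₂ dim V_j` for `θ ≥ 0`, given Schur–Weyl
vanishing. [cite: ChristandlVranaZuiddam2023, Def. 3.3] -/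
theorem weightedPartitionEntropy_le (hSW : schurWeyl_isotypicSum_eq_zero.{u}) {θ : Fin 3 → ℝ}
    (hθ : ∀ j, 0 ≤ θ j) {t : ι → κ → μ → ℂ} {n : ℕ} {lam : Fin 3 → Nat.Partition n}
    (h : UpperAdmissible θ t n lam) :
    weightedPartitionEntropy θ lam ≤ θ 0 * (Real.log (Fintype.card ι) / Real.log 2) +
      θ 1 * (Real.log (Fintype.card κ) / Real.log 2) + θ 2 * (Real.log (Fintype.card μ) / Real.log 2) := by
  have h2 : 0 < Real.log 2 := Real.log_pos one_lt_two
  have key : ∀ {m : ℕ} (lam : Nat.Partition n), Multiset.card lam.parts ≤ m →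
      partitionEntropy lam ≤ Real.log m / Real.log 2 := by
    intro m lam hm
    refine (partitionEntropy_le_log_card lam).trans (div_le_div_of_nonneg_right ?_ h2.le)
    rcases Nat.eq_zero_or_pos (Multiset.card lam.parts) with h0 | hpos
    · rw [h0, Nat.cast_zero, Real.log_zero]
      exact Real.log_natCast_nonneg m
    · exact Real.log_le_log (by exact_mod_cast hpos) (by exact_mod_cast hm)
  -- each term: either `θ j = 0` or `ℓ(λ^{(j)}) ≤ dim V_j`
  have term : ∀ {m : ℕ} (c : ℝ) (lam : Nat.Partition n), 0 ≤ c →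
      (c ≠ 0 → Multiset.card lam.parts ≤ m) → c * partitionEntropy lam ≤ c * (Real.log m / Real.log 2) := by
    intro m c lam hc hcl
    by_cases hc0 : c = 0
    · simp [hc0]
    · exact mul_le_mul_of_nonneg_left (key _ (hcl hc0)) hc
  obtain ⟨h₁, h₂, h₃⟩ := h.card_parts_le hSW
  exact add_le_add (add_le_add (term _ _ (hθ 0) h₁) (term _ _ (hθ 1) h₂)) (term _ _ (hθ 2) h₃)

/-- `E^θ(t) ≤ θ(1) log₂|ι| + θ(2) log₂|κ| + θ(3) log₂|μ|` for `θ ≥ 0`, given Schur–Weyl vanishing: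
the defining supremum is over a bounded set (empty for `t = 0`).
[cite: ChristandlVranaZuiddam2023, Def. 3.3] -/
theorem upperLogQuantumFunctional_le (hSW : schurWeyl_isotypicSum_eq_zero.{u}) {θ : Fin 3 → ℝ}
    (hθ : ∀ j, 0 ≤ θ j) (t : ι → κ → μ → ℂ) :
    upperLogQuantumFunctional θ t ≤ θ 0 * (Real.log (Fintype.card ι) / Real.log 2) +
      θ 1 * (Real.log (Fintype.card κ) / Real.log 2) + θ 2 * (Real.log (Fintype.card μ) / Real.log 2) := by
  refine Real.sSup_le ?_ ?_
  · rintro x ⟨n, lam, -, hadm, rfl⟩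
    exact weightedPartitionEntropy_le hSW hθ hadm
  · have hl : ∀ m : ℕ, 0 ≤ Real.log m / Real.log 2 := fun m =>
      div_nonneg (Real.log_natCast_nonneg m) (Real.log_nonneg one_le_two)
    exact add_nonneg (add_nonneg (mul_nonneg (hθ 0) (hl _)) (mul_nonneg (hθ 1) (hl _)))
      (mul_nonneg (hθ 2) (hl _))

/-- **Bounded above**: given Schur–Weyl vanishing, the defining set of `E^θ(t)` is bounded above, so
`sSup` is a genuine supremum (`le_csSup` applies). [cite: ChristandlVranaZuiddam2023, Def. 3.3] -/
theorem bddAbove_upperAdmissible_values (hSW : schurWeyl_isotypicSum_eq_zero.{u}) {θ : Fin 3 → ℝ}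
    (hθ : ∀ j, 0 ≤ θ j) (t : ι → κ → μ → ℂ) :
    BddAbove {x : ℝ | ∃ (n : ℕ) (lam : Fin 3 → Nat.Partition n),
      0 < n ∧ UpperAdmissible θ t n lam ∧ x = weightedPartitionEntropy θ lam} :=
  ⟨_, by
    rintro x ⟨n, lam, -, hadm, rfl⟩
    exact weightedPartitionEntropy_le hSW hθ hadm⟩

/-- An admissible tuple bounds `E^θ(t)` from below (given Schur–Weyl vanishing, for boundedness).
[cite: ChristandlVranaZuiddam2023, Def. 3.3] -/
theorem weightedPartitionEntropy_le_upperLogQuantumFunctional (hSW : schurWeyl_isotypicSum_eq_zero.{u})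
    {θ : Fin 3 → ℝ} (hθ : ∀ j, 0 ≤ θ j) {t : ι → κ → μ → ℂ} {n : ℕ} (hn : 0 < n)
    {lam : Fin 3 → Nat.Partition n} (h : UpperAdmissible θ t n lam) :
    weightedPartitionEntropy θ lam ≤ upperLogQuantumFunctional θ t :=
  le_csSup (bddAbove_upperAdmissible_values hSW hθ t) ⟨n, lam, hn, h, rfl⟩

omit [Fintype ι] [Fintype κ] [Fintype μ] in
/-- For `t = 0` no tuple is admissible (`0^{⊗n} = 0` for `n ≥ 1`), so `E^θ(0) = 0`. [folklore] -/
theorem upperLogQuantumFunctional_zero (θ : Fin 3 → ℝ) :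
    upperLogQuantumFunctional θ (0 : ι → κ → μ → ℂ) = 0 := by
  have hset : {x : ℝ | ∃ (n : ℕ) (lam : Fin 3 → Nat.Partition n),
      0 < n ∧ UpperAdmissible θ (0 : ι → κ → μ → ℂ) n lam ∧ x = weightedPartitionEntropy θ lam} = ∅ := by
    ext x
    simp only [Set.mem_setOf_eq, Set.mem_empty_iff_false, iff_false]
    rintro ⟨n, lam, hn, hadm, -⟩
    apply hadm
    have h0 : kroneckerPow (0 : ι → κ → μ → ℂ) n = 0 := by
      funext a b c
      rw [kroneckerPow_apply]
      exact Finset.prod_eq_zero (Finset.mem_univ ⟨0, hn⟩) rfl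
    rw [h0, upperProjection_zero]
  rw [upperLogQuantumFunctional, hset, Real.sSup_empty]

/-- `F^θ(0) = 0`. [cite: ChristandlVranaZuiddam2023, Def. 3.3] -/
@[simp] theorem upperQuantumFunctional_zero [DecidableEq ι] [DecidableEq κ] [DecidableEq μ]
    (θ : Fin 3 → ℝ) : upperQuantumFunctional θ (0 : ι → κ → μ → ℂ) = 0 := if_pos rfl

/-- `F^θ(t) = 2^{E^θ(t)}` for `t ≠ 0`. [cite: ChristandlVranaZuiddam2023, Def. 3.3] -/
theorem upperQuantumFunctional_of_ne_zero [DecidableEq ι] [DecidableEq κ] [DecidableEq μ]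
    (θ : Fin 3 → ℝ) {t : ι → κ → μ → ℂ} (ht : t ≠ 0) :
    upperQuantumFunctional θ t = (2 : ℝ) ^ upperLogQuantumFunctional θ t := if_neg ht

/-- `F^θ(t) ≥ 0`. [folklore] -/
theorem upperQuantumFunctional_nonneg [DecidableEq ι] [DecidableEq κ] [DecidableEq μ]
    (θ : Fin 3 → ℝ) (t : ι → κ → μ → ℂ) : 0 ≤ upperQuantumFunctional θ t := by
  unfold upperQuantumFunctional
  split_ifs
  · exact le_rfl
  · exact Real.rpow_nonneg zero_le_two _

end Upper

/-! ## Named facts: Lemma 3.11, Lemma 3.13, Thm. 3.30 (statements, `k = 3`) -/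

section Facts

/-- **CVZ Lemma 3.11 (sub-additivity of the upper quantum functional), `k = 3`**: for
`θ ∈ P_nc(B)` — for `k = 3` every `θ ∈ P([3])` — and complex 3-tensors `s`, `t`,
`F^θ(s ⊕ t) ≤ F^θ(s) + F^θ(t)` (proved in the source from the semigroup property of the
Littlewood–Richardson coefficients, Rem. 3.9, the entropy inequality Lemma 3.10.2 and Lemma 3.12).
[cite: ChristandlVranaZuiddam2023, Lemma 3.11] -/
def ChristandlVranaZuiddam2023_upper_subadditive : Prop :=
  ∀ (θ : Fin 3 → ℝ), θ ∈ stdSimplex ℝ (Fin 3) →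
    ∀ {ι κ μ ι' κ' μ' : Type u} [Fintype ι] [Fintype κ] [Fintype μ] [Fintype ι'] [Fintype κ']
      [Fintype μ'] [DecidableEq ι] [DecidableEq κ] [DecidableEq μ] [DecidableEq ι'] [DecidableEq κ']
      [DecidableEq μ'] (s : ι → κ → μ → ℂ) (t : ι' → κ' → μ' → ℂ),
    upperQuantumFunctional θ (directSumTensor s t) ≤
      upperQuantumFunctional θ s + upperQuantumFunctional θ t

/-- **CVZ Lemma 3.13 (sub-multiplicativity of the upper quantum functional), `k = 3`**: for
`θ ∈ P_nc(B) ⊇ P([3])` and complex 3-tensors `s`, `t`, `F^θ(s ⊗ t) ≤ F^θ(s) F^θ(t)`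
(semigroup property of the Kronecker coefficients, Rem. 3.9, and `g_{λμν} ≠ 0 ⇒ H(λ̄) ≤ H(μ̄) + H(ν̄)`,
Lemma 3.10.1). [cite: ChristandlVranaZuiddam2023, Lemma 3.13] -/
def ChristandlVranaZuiddam2023_upper_submultiplicative : Prop :=
  ∀ (θ : Fin 3 → ℝ), θ ∈ stdSimplex ℝ (Fin 3) →
    ∀ {ι κ μ ι' κ' μ' : Type u} [Fintype ι] [Fintype κ] [Fintype μ] [Fintype ι'] [Fintype κ']
      [Fintype μ'] [DecidableEq ι] [DecidableEq κ] [DecidableEq μ] [DecidableEq ι'] [DecidableEq κ']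
      [DecidableEq μ'] (s : ι → κ → μ → ℂ) (t : ι' → κ' → μ' → ℂ),
    upperQuantumFunctional θ (kroneckerTensor s t) ≤
      upperQuantumFunctional θ s * upperQuantumFunctional θ t

/-- **CVZ Thm. 3.30 (the two quantum functionals coincide in the singleton regime)**: for
`θ ∈ P_s(B)` — for `k = 3`, all of `P([3])` — and every nonzero complex 3-tensor `t`,
`E^θ(t) = E_θ(t)`, where `E_θ = logQuantumFunctional θ` is the lower functional of Def. 3.16
(`QuantumFunctionals.lean`). The printed proof combines `E^θ ≥ E_θ` (Thm. 3.24: Keyl–Werner spectrum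
estimation Thm. 3.27 / Cor. 3.28 and the gentle measurement lemma 3.25 / Cor. 3.26) with the
entanglement-polytope characterisation Thm. 3.29 (Brion; Walter–Doran–Gross–Christandl; Ness–Mumford).
[cite: ChristandlVranaZuiddam2023, Thm. 3.30] -/
def ChristandlVranaZuiddam2023_upper_eq_lower : Prop :=
  ∀ (θ : Fin 3 → ℝ), θ ∈ stdSimplex ℝ (Fin 3) →
    ∀ {ι κ μ : Type u} [Fintype ι] [Fintype κ] [Fintype μ] [DecidableEq ι] [DecidableEq κ]
      [DecidableEq μ] (t : ι → κ → μ → ℂ), t ≠ 0 →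
    upperLogQuantumFunctional θ t = logQuantumFunctional θ t

/-! ## Reductions (proved) -/

/-- Under Thm. 3.30, `F^θ = F_θ` on all complex 3-tensors (`F^θ(0) = F_θ(0) = 0`).
[cite: ChristandlVranaZuiddam2023, Thm. 3.30] -/
theorem upperQuantumFunctional_eq_quantumFunctional (h : ChristandlVranaZuiddam2023_upper_eq_lower.{u})
    {θ : Fin 3 → ℝ} (hθ : θ ∈ stdSimplex ℝ (Fin 3)) {ι κ μ : Type u} [Fintype ι] [Fintype κ]
    [Fintype μ] [DecidableEq ι] [DecidableEq κ] [DecidableEq μ] (t : ι → κ → μ → ℂ) :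
    upperQuantumFunctional θ t = quantumFunctional θ t := by
  by_cases ht : t = 0
  · subst ht
    rw [upperQuantumFunctional_zero, quantumFunctional_zero]
  · rw [upperQuantumFunctional_of_ne_zero θ ht, quantumFunctional_of_ne_zero θ ht, h θ hθ t ht]

/-- **Lemma 3.13 + Thm. 3.30 ⇒ sub-multiplicativity of `F_θ`**, i.e. the named fact
`ChristandlVranaZuiddam2023_kronecker_le` (the `≤` half of the multiplicativity in Cor. 3.31).
[cite: ChristandlVranaZuiddam2023, Cor. 3.31] -/
theorem ChristandlVranaZuiddam2023_kronecker_le_of_upper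
    (h₁ : ChristandlVranaZuiddam2023_upper_submultiplicative.{u})
    (h₂ : ChristandlVranaZuiddam2023_upper_eq_lower.{u}) :
    ChristandlVranaZuiddam2023_kronecker_le.{u} := by
  intro θ hθ ι κ μ ι' κ' μ' _ _ _ _ _ _ _ _ _ _ _ _ s t
  rw [← upperQuantumFunctional_eq_quantumFunctional h₂ hθ,
    ← upperQuantumFunctional_eq_quantumFunctional h₂ hθ,
    ← upperQuantumFunctional_eq_quantumFunctional h₂ hθ]
  exact h₁ θ hθ s t

/-- **Lemma 3.13 + Thm. 3.30 ⇒ multiplicativity of `F_θ`** (the `_kronecker` fact of Cor. 3.31), via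
the sibling reduction `ChristandlVranaZuiddam2023_kronecker_of_le` and the proved
super-multiplicativity. [cite: ChristandlVranaZuiddam2023, Cor. 3.31] -/
theorem ChristandlVranaZuiddam2023_kronecker_of_upper
    (h₁ : ChristandlVranaZuiddam2023_upper_submultiplicative.{u})
    (h₂ : ChristandlVranaZuiddam2023_upper_eq_lower.{u}) :
    ChristandlVranaZuiddam2023_kronecker.{u} :=
  ChristandlVranaZuiddam2023_kronecker_of_le (ChristandlVranaZuiddam2023_kronecker_le_of_upper h₁ h₂)

/-- **Lemma 3.11 + Thm. 3.30 ⇒ sub-additivity of `F_θ`**: `F_θ(s ⊕ t) ≤ F_θ(s) + F_θ(t)` for all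
`θ ∈ P([3])` and complex 3-tensors (the `≤` half of the additivity in Cor. 3.31).
[cite: ChristandlVranaZuiddam2023, Cor. 3.31] -/
theorem quantumFunctional_directSumTensor_le_of_upper
    (h₁ : ChristandlVranaZuiddam2023_upper_subadditive.{u})
    (h₂ : ChristandlVranaZuiddam2023_upper_eq_lower.{u}) {θ : Fin 3 → ℝ}
    (hθ : θ ∈ stdSimplex ℝ (Fin 3)) {ι κ μ ι' κ' μ' : Type u} [Fintype ι] [Fintype κ] [Fintype μ]
    [Fintype ι'] [Fintype κ'] [Fintype μ'] [DecidableEq ι] [DecidableEq κ] [DecidableEq μ]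
    [DecidableEq ι'] [DecidableEq κ'] [DecidableEq μ'] (s : ι → κ → μ → ℂ) (t : ι' → κ' → μ' → ℂ) :
    quantumFunctional θ (directSumTensor s t) ≤ quantumFunctional θ s + quantumFunctional θ t := by
  rw [← upperQuantumFunctional_eq_quantumFunctional h₂ hθ,
    ← upperQuantumFunctional_eq_quantumFunctional h₂ hθ,
    ← upperQuantumFunctional_eq_quantumFunctional h₂ hθ]
  exact h₁ θ hθ s t

end Facts

end Literature.Computability.AlgebraicComplexity

end
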